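import Summits.ValiantsHypothesis.ValiantsHypothesis.Theorems.DivisionGapPerDivisionHardStubBlockArsenal
import Summits.ValiantsHypothesis.ValiantsHypothesis.Theorems.DivisionGapPerDivisionHardStubFaceDescent
import Summits.ValiantsHypothesis.ValiantsHypothesis.Theorems.ZeroOneTransfer.Negative.TopComponentFree

/-!
# Crux `DivisionGap.PerDivisionHard` (stmt-ValiantsHypothesis-5065), line
`pair-descent-jss-endpoint` — negative lemma `perMul_not_hasSingleGPart`: per-multiples are
omnipresent on the block arsenal

The line reaches the crux through K2: at some placement `eR eC` of the block arsenal
`G = placedBlock eR eC` and some weight `w` cutting out `G`, the top-`w` fibre of the cofactor has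
a SINGLE `G`-part `u` (`HasSingleGPart G w h u`).  This file records the intrinsic obstruction for
PER-MULTIPLE cofactors `h = per_n · g` (`g ≠ 0`): K2 fails at EVERY placement (`b ≥ 2`, `k ≥ 1`)
and EVERY cutting weight.

Proof.  Initial forms are multiplicative over `ℝ≥0` and `w` cuts out `G`, so
`top_w(per_n · g) = top_w(per_n) · top_w(g) = facePer G · top_w(g)` (`topComponent_mul`,
`topComponent_perPoly_eq_facePer`), and over `ℝ≥0` supports multiply exactly
(`JerrumSnir.support_mul_eq`).  Fix a monomial `m₀` of `top_w(g)`.  The two canonical perfect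
matchings `canonMatch 1` and `canonMatch (swap 0 1)` of the label graph `G(b,k) ⊕ M₀`
(`blockAdj_canonMatch`, `canonMatch_bijective`), placed along `eR eC`, are permutations
`σ₁ σ₂` inside `G`; core row `0` is matched to the internal column `(0, 0, 0)` by the first and
to `(0, 1, 0)` by the second, so the permutation monomials `x^{μ_σ₁}`, `x^{μ_σ₂}` differ (value
`1` vs `0`) at the cell `e = (eR (core 0), eC (0, 0, 0)) ∈ G`.  Both `μ_σ₁ + m₀` and `μ_σ₂ + m₀`
lie in the top fibre, and no single `u` agrees with both at `e`.
-/

noncomputable section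

-- `Summit.ValiantsHypothesis.ValiantsHypothesis.…` is the tree's mandated single-conjunct layout
-- (Sub = Summit), so the duplicated namespace component is intended.
set_option linter.dupNamespace false

namespace Summit.ValiantsHypothesis.ValiantsHypothesis.Theorems.DivisionGapPerDivisionHard

open MvPolynomial Literature.Computability.AlgebraicComplexity
open Summit.ValiantsHypothesis.ValiantsHypothesis.Theorems.ZeroOneTransfer.Negative
open scoped NNReal Pointwise

variable {b k m n : ℕ}

/-! ### Placing a perfect matching of the label graph -/

-- adapted from `exists_perm_mem_placedBlock` (StubSparseRigid), keeping the permutation explicit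
/-- A row matching `M` (rows ↦ columns) of the label graph, placed along `eR eC` as the
permutation `eC.symm.trans (M.symm.trans eR)` of `Fin n` (column `x` ↦ the row matched to it),
lies inside the placed block graph. [folklore] -/
private theorem placedMatching_mem (eR eC : BlockV b k m ≃ Fin n)
    {M : BlockV b k m ≃ BlockV b k m} (hM : ∀ r, blockAdj b k m r (M r) = true) (x : Fin n) :
    (eC.symm.trans (M.symm.trans eR) x, x) ∈ placedBlock eR eC := by
  simp only [placedBlock, Finset.mem_filter, Finset.mem_univ, true_and, Equiv.trans_apply,
    Equiv.symm_apply_apply]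
  simpa using hM (M.symm (eC.symm x))

/-- The permutation monomial of a placed matching at the placed cell `(eR r, eC c)` is `[M r = c]`.
[folklore] -/
private theorem permMonomial_placedMatching (eR eC : BlockV b k m ≃ Fin n)
    (M : BlockV b k m ≃ BlockV b k m) (r c : BlockV b k m) :
    permMonomial (eC.symm.trans (M.symm.trans eR)) (eR r, eC c) = if M r = c then 1 else 0 := by
  rw [permMonomial_apply]
  simp only [Equiv.trans_apply, Equiv.symm_apply_apply, EmbeddingLike.apply_eq_iff_eq,
    Equiv.symm_apply_eq]
  by_cases h : M r = c
  · rw [if_pos h.symm, if_pos h]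
  · rw [if_neg (fun h' => h h'.symm), if_neg h]

/-- For `k ≥ 1` the canonical matching sends core row `i` to the first internal column
`(i, ρ i, 0)` of its path. [folklore] -/
private theorem canonMatch_core (hk : 0 < k) (ρ : Equiv.Perm (Fin b)) (i : Fin b) :
    canonMatch (k := k) (m := m) ρ (Sum.inl i) = Sum.inr (Sum.inl (i, ρ i, ⟨0, hk⟩)) := by
  simp [canonMatch, hk]

/-! ### Coefficients of the face permanent -/

/-- The face permanent has coefficient `1` on the permutation monomial of a permutation inside
`G`. [folklore] -/
private theorem coeff_permMonomial_facePer_of_mem (G : Finset (Fin n × Fin n))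
    {σ : Equiv.Perm (Fin n)} (hσ : ∀ i, (σ i, i) ∈ G) :
    coeff (permMonomial σ) (facePer G) = 1 := by
  classical
  unfold facePer
  rw [coeff_sum]
  simp only [coeff_monomial, permMonomial_injective.eq_iff]
  rw [Finset.sum_ite_eq']
  simp [hσ]

/-- The top fibre of a per-multiple `per_n · g` in a direction cutting out `G` contains
`μ_σ + m₀` for every permutation `σ` inside `G` and every monomial `m₀` of `top_w(g)`.
[folklore] -/
private theorem permMonomial_add_mem_support_topComponent {G : Finset (Fin n × Fin n)}
    {w : Fin n × Fin n → ℕ} (hcut : CutsOut w G) (g : MvPolynomial (Fin n × Fin n) ℝ≥0)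
    {σ : Equiv.Perm (Fin n)} (hσ : ∀ i, (σ i, i) ∈ G) {m₀ : (Fin n × Fin n) →₀ ℕ}
    (hm₀ : m₀ ∈ (topComponent w g).support) :
    permMonomial σ + m₀ ∈ (topComponent w (perPoly (Fin n) ℝ≥0 * g)).support := by
  classical
  rw [topComponent_mul, topComponent_perPoly_eq_facePer hcut,
    Literature.Barriers.ValiantsHypothesis.JerrumSnir.support_mul_eq]
  refine Finset.add_mem_add (mem_support_iff.mpr ?_) hm₀
  rw [coeff_permMonomial_facePer_of_mem G hσ]
  exact one_ne_zero

/-! ### The lemma -/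

/-- **Per-multiples are omnipresent (negative lemma of line `pair-descent-jss-endpoint`).**  For a
placement `eR eC` of the block arsenal `G(b,k) ⊕ M₀` with `b ≥ 2`, `k ≥ 1`, a nonzero `g`, and a
weight `w` cutting out the placed face `G`, the top-`w` fibre of `per_n · g` never has a single
`G`-part: it is `facePer G · top_w(g)`, which contains `μ_σ₁ + m₀` and `μ_σ₂ + m₀` for the placed
canonical matchings `σ₁ = canonMatch 1`, `σ₂ = canonMatch (swap 0 1)`, and these differ at the
cell `(core row 0, internal column (0,0,0)) ∈ G`. [folklore] -/
theorem perMul_not_hasSingleGPart :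
    ∀ (b k m n : ℕ) (eR eC : BlockV b k m ≃ Fin n) (g : MvPolynomial (Fin n × Fin n) ℝ≥0)
      (w : Fin n × Fin n → ℕ) (u : (Fin n × Fin n) →₀ ℕ),
      2 ≤ b → 0 < k → g ≠ 0 → CutsOut w (placedBlock eR eC) →
      ¬ HasSingleGPart (placedBlock eR eC) w (perPoly (Fin n) ℝ≥0 * g) u := by
  intro b k m n eR eC g w u hb hk hg hcut hu
  -- the two core indices `0 ≠ 1`
  set i₀ : Fin b := ⟨0, by omega⟩ with hi₀
  set i₁ : Fin b := ⟨1, by omega⟩ with hi₁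
  have hne : i₁ ≠ i₀ := fun h => by
    have := congrArg Fin.val h
    simp [hi₀, hi₁] at this
  -- the two placed canonical matchings `canonMatch 1`, `canonMatch (swap 0 1)`
  set M₁ : BlockV b k m ≃ BlockV b k m :=
    Equiv.ofBijective _ (canonMatch_bijective (k := k) (m := m) (1 : Equiv.Perm (Fin b))) with hM₁
  set M₂ : BlockV b k m ≃ BlockV b k m :=
    Equiv.ofBijective _ (canonMatch_bijective (k := k) (m := m) (Equiv.swap i₀ i₁)) with hM₂
  have hσ₁ : ∀ x, (eC.symm.trans (M₁.symm.trans eR) x, x) ∈ placedBlock eR eC :=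
    placedMatching_mem eR eC fun r => blockAdj_canonMatch 1 r
  have hσ₂ : ∀ x, (eC.symm.trans (M₂.symm.trans eR) x, x) ∈ placedBlock eR eC :=
    placedMatching_mem eR eC fun r => blockAdj_canonMatch (Equiv.swap i₀ i₁) r
  -- the distinguishing cell: core row `0`, internal column `(0, 0, 0)`
  set c₀ : BlockV b k m := Sum.inr (Sum.inl (i₀, i₀, ⟨0, hk⟩)) with hc₀
  have he : (eR (Sum.inl i₀), eC c₀) ∈ placedBlock eR eC := by
    simp [placedBlock, hc₀, blockAdj]
  have h1 : permMonomial (eC.symm.trans (M₁.symm.trans eR)) (eR (Sum.inl i₀), eC c₀) = 1 := by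
    rw [permMonomial_placedMatching, if_pos]
    rw [hM₁, Equiv.ofBijective_apply, canonMatch_core hk]
    rfl
  have h2 : permMonomial (eC.symm.trans (M₂.symm.trans eR)) (eR (Sum.inl i₀), eC c₀) = 0 := by
    rw [permMonomial_placedMatching, if_neg]
    rw [hM₂, Equiv.ofBijective_apply, canonMatch_core hk, Equiv.swap_apply_left, hc₀]
    simp only [Sum.inr.injEq, Sum.inl.injEq, Prod.mk.injEq, true_and, and_true]
    exact hne
  -- a monomial of the top fibre of `g` and the two fibre monomials of `per_n · g`
  obtain ⟨m₀, hm₀⟩ := support_nonempty.mpr (topComponent_ne_zero w hg)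
  have hu₁ := hu.2 _ (permMonomial_add_mem_support_topComponent hcut g hσ₁ hm₀) _ he
  have hu₂ := hu.2 _ (permMonomial_add_mem_support_topComponent hcut g hσ₂ hm₀) _ he
  rw [Finsupp.add_apply] at hu₁ hu₂
  rw [h1] at hu₁
  rw [h2] at hu₂
  omega

end Summit.ValiantsHypothesis.ValiantsHypothesis.Theorems.DivisionGapPerDivisionHard

end
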